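import Literature.MathematicalPhysics.QuantumFieldTheory.O2NeutralSectorsTermwise
import Literature.MathematicalPhysics.QuantumFieldTheory.O2ScanObligationsWard
import Literature.MathematicalPhysics.QuantumFieldTheory.ConformalBootstrap3D.MixedEvenTail
import HarnessLib

/-!
# O(2) `{φ, s, t}` scan: BOXES of external dimensions — the `D`-uniform toolkit and the unit item (rule (I))

Topic: `Literature/MathematicalPhysics/QuantumFieldTheory` (conformal bootstrap; verifier-B / `certsdp`
client path of the ENGINES group).  HONEST FRAMING: shared numerical engines serving client cells; rigour
lives in the verifiers; every published number belongs to a client cell's ledger, not to the engines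
group.  A Literature module: published statements re-proved in the kernel over the tree's own objects — no
named facts, no `sorry`, nothing numerical.

The unit (normalisation) item `UnitPos α D` of a scan functional `α = F.toFunctional` (a finite
combination of point evaluations at nodes `(z_m, z̄_m)` of the open square, Chester–Landry–Liu–Poland–
Simmons-Duffin–Su–Vichi 2020, §3.1) at external dimensions `D = (Δ_s, Δ_φ, Δ_t)` is the explicit number
`u_F(D) = (1 1 1)·(Σ_m Σ_r w_{m r} V⃗_{0⁺, r}[unit](u_m, v_m))·(1 1 1)ᵀ > 0` (tree:
`unitPos_toFunctional_iff`), and the `22` entries of the unit vector are `±2 (v^s ± u^s)` in the SIX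
exponent families `s ∈ {Δ_φ, Δ_t, (Δ_φ+Δ_t)/2, Δ_s, (Δ_s+Δ_t)/2, (Δ_φ+Δ_s)/2}` (tree: `quad0p_unit`,
Chester et al. §3.1, `V⃗_{0⁺,0,0}`).  This file makes rule (I) of a table certificate UNIFORM IN THE
EXTERNAL DIMENSIONS, exactly as the single- and mixed-correlator tables do for `Δ_σ ∈ [σ_lo, σ_hi]`
(tree: `identity_pos_of_cornerBound`, `identityTerm_ofPoints_pos_of_cornerBounds`), and supplies the
two lemmas every other `D`-uniform rule will use:
0. `InDimBox lo hi D` (componentwise box), `expo_mem_Icc` — each of the fifteen printed exponents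
   `(Δ_k+Δ_j)/2` (`Dims.expo`) lies between its corner values — and `twoWeightEval_mem_Icc_corner₂` /
   `twoWeightEval_mem_Icc_corner_expo` — the two-sided corner enclosure of a two-weight evaluation on a
   box `E ∈ [E₁,E₂]`, `s ∈ [s_lo,s_hi]` (the tree's `twoWeightEval_mem_Icc_corner` is `s_lo = s_hi`);
1. `unitNumber_eq_families` — `u_F(D)` is the sum over the six families of the tree's two-weight
   evaluations `twoWeightEval c_f d_f z z̄ s_f(D) 1` with CLOSED-FORM combined weights
   (`unitFamC`, `unitFamD`: e.g. family `Δ_φ` has `c = 2(w₀ − w₂)`, `d = 2(w₀ + w₂)` from the rows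
   `2(v^{Δφ} − u^{Δφ})` (row 0) and `−2(v^{Δφ} + u^{Δφ})` (row 2));
2. `unitCorner_le_unitNumber` — on a box `lo ≤ D ≤ hi` (componentwise in `(Δ_s, Δ_φ, Δ_t)`) every
   family exponent lies between its values at `lo` and `hi`, so the tree's corner bound
   `cornerBound₂ c_f d_f z z̄ 0 0 0 s_f(lo) s_f(hi)` (positive parts of the weights at the far corner,
   negative parts at the near corner; `cornerBound₂_le`) bounds each family from below, uniformly on the
   box;
3. `unitPos_on_box_of_unitCorner` — rule (I) on a box: the ONE closed-form number
   `unitCorner F lo hi > 0` gives `UnitPos F.toFunctional D` for EVERY `D` in the box (the per-point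
   item is the case `lo = hi = D`, `unitPos_of_unitCorner_self`).
This is the first item of the `D`-uniform layer of an `O(2)` cell certificate (Chester et al. test
finitely many points and triangulate, §3.3–§3.4; a certificate for a CELL of external dimensions needs every
item uniformly on the cell).  Nothing here is specific to `O(2)` beyond the unit vector's row pattern.
-/

noncomputable section

namespace Literature.MathematicalPhysics.QuantumFieldTheory.O2DimBox

open Set Finset Matrix
open Literature.MathematicalPhysics.QuantumFieldTheory.ConformalBootstrap3D
open O2ThreeScalarCrossing O2ThreeScalarSystem O2OPEScanBridge O2ScanObligations O2ScanObligationsWard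
open O2NeutralSectorsTermwise (sum_univ_fin22)

/-! ## 0. Boxes of external dimensions: the toolkit of the `D`-uniform layer -/

/-- `lo ≤ D ≤ hi` componentwise in `(Δ_s, Δ_φ, Δ_t)`. [cite: ChesterEtAl2020, §3.3 (scanning over external dimensions)] -/
def InDimBox (lo hi D : Dims) : Prop :=
  (lo.Δs ≤ D.Δs ∧ D.Δs ≤ hi.Δs) ∧ (lo.Δφ ≤ D.Δφ ∧ D.Δφ ≤ hi.Δφ) ∧ (lo.Δt ≤ D.Δt ∧ D.Δt ≤ hi.Δt)

/-- **Every printed exponent `(Δ_k + Δ_j)/2` of the `F`-symbols lies between its values at the box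
corners** (all fifteen are half-sums of external dimensions, hence monotone in each of `Δ_s, Δ_φ, Δ_t`).
[cite: ChesterEtAl2020, §2.1 (`F^{ij,kl}_{∓,Δ,ℓ}`: exponents `(Δ_k+Δ_j)/2`)] -/
theorem expo_mem_Icc {lo hi D : Dims} (h : InDimBox lo hi D) (L : Label) :
    D.expo L ∈ Icc (lo.expo L) (hi.expo L) := by
  obtain ⟨⟨hs1, hs2⟩, ⟨hp1, hp2⟩, ⟨ht1, ht2⟩⟩ := h
  cases L <;> simp only [Dims.expo, Set.mem_Icc] <;> constructor <;> linarith

/-- **Two-sided corner enclosure of a two-weight evaluation on a box `E ∈ [E₁, E₂]`, `s ∈ [s_lo, s_hi]`**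
(the tree's `twoWeightEval_mem_Icc_corner` is the case `s_lo = s_hi`): lower corner number
`cornerBound₂ c d`, upper corner number `−cornerBound₂ (−c) (−d)`.  With `expo_mem_Icc` this is what turns
every per-point (M) rule of the seven sectors (entries `twoWeightEval c d z z̄ (D.expo L) (𝒫_{E,j})`) into a
rule uniform on a box of external dimensions. [cite: HogervorstRychkov2013, §3 eq. (3.6)]
[cite: ChesterEtAl2020, §3.3 (scanning over external dimensions)] -/
theorem twoWeightEval_mem_Icc_corner₂ (F : ScanFunctional) (c d : Fin F.M → ℝ) (j : ℕ)
    {E₁ E₂ E slo shi s : ℝ} (hE : E ∈ Icc E₁ E₂) (hs : s ∈ Icc slo shi) :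
    cornerBound₂ c d F.z F.zb j E₁ E₂ slo shi ≤ twoWeightEval c d F.z F.zb s (zMono E j) ∧
      twoWeightEval c d F.z F.zb s (zMono E j) ≤ -cornerBound₂ (-c) (-d) F.z F.zb j E₁ E₂ slo shi := by
  refine ⟨cornerBound₂_le c d F.z F.zb F.hz F.hzb j hE hs, ?_⟩
  have h := cornerBound₂_le (-c) (-d) F.z F.zb F.hz F.hzb j hE hs
  rw [twoWeightEval_neg] at h
  linarith

/-- The same at the exponent of a label on a box of external dimensions.
[cite: ChesterEtAl2020, §2.1 (`F^{ij,kl}_{∓,Δ,ℓ}`), §3.3 (scanning over external dimensions)] -/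
theorem twoWeightEval_mem_Icc_corner_expo (F : ScanFunctional) (c d : Fin F.M → ℝ) (j : ℕ)
    {E₁ E₂ E : ℝ} (hE : E ∈ Icc E₁ E₂) {lo hi D : Dims} (hD : InDimBox lo hi D) (L : Label) :
    cornerBound₂ c d F.z F.zb j E₁ E₂ (lo.expo L) (hi.expo L) ≤
        twoWeightEval c d F.z F.zb (D.expo L) (zMono E j) ∧
      twoWeightEval c d F.z F.zb (D.expo L) (zMono E j) ≤
        -cornerBound₂ (-c) (-d) F.z F.zb j E₁ E₂ (lo.expo L) (hi.expo L) :=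
  twoWeightEval_mem_Icc_corner₂ F c d j hE (expo_mem_Icc hD L)

/-! ## 1. The unit number and its six exponent families -/

/-- The unit number `u_F(D) = (1 1 1)·(Σ_m Σ_r w_{m r} V⃗_{0⁺,r}[unit](u_m, v_m))·(1 1 1)ᵀ` of a scan
functional. [cite: ChesterEtAl2020, §3.1 (functional conditions: normalisation on the unit operator)] -/
def unitNumber (F : ScanFunctional) (D : Dims) : ℝ :=
  ![(1 : ℝ), 1, 1] ⬝ᵥ ((∑ m, ∑ r, F.w m r • V0p D unitBlocks (F.u m) (F.v m) r) *ᵥ ![(1 : ℝ), 1, 1])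

/-- `UnitPos F.toFunctional D ↔ 0 < u_F(D)`. [cite: ChesterEtAl2020, §3.1 (functional conditions)] -/
theorem unitPos_iff (F : ScanFunctional) (D : Dims) : UnitPos F.toFunctional D ↔ 0 < unitNumber F D :=
  unitPos_toFunctional_iff F D

/-- The six exponents `(Δ_φ, Δ_t, (Δ_φ+Δ_t)/2, Δ_s, (Δ_s+Δ_t)/2, (Δ_φ+Δ_s)/2)` of the unit vector.
[cite: ChesterEtAl2020, §3.1 (unit operator, `V⃗_{0⁺,0,0}`)] -/
def unitFamExpo (D : Dims) : Fin 6 → ℝ :=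
  ![D.Δφ, D.Δt, (D.Δφ + D.Δt) / 2, D.Δs, (D.Δs + D.Δt) / 2, (D.Δφ + D.Δs) / 2]

/-- The combined DIRECT weights `c_f` (coefficient of `v^{s_f}`) of the six families, node by node:
`2(w₀ − w₂), 2(w₃ − w₅), 2(w₈ + w₉ − w₁₀ − w₁₁), 2 w₁₂, 2(w₁₅ + w₁₆), 2(w₁₇ + w₁₈)`.
[cite: ChesterEtAl2020, §3.1 (unit operator, `V⃗_{0⁺,0,0}`)] -/
def unitFamC (F : ScanFunctional) (f : Fin 6) (m : Fin F.M) : ℝ :=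
  ![2 * (F.w m 0 - F.w m 2), 2 * (F.w m 3 - F.w m 5),
    2 * (F.w m 8 + F.w m 9 - F.w m 10 - F.w m 11), 2 * F.w m 12,
    2 * (F.w m 15 + F.w m 16), 2 * (F.w m 17 + F.w m 18)] f

/-- The combined REFLECTED weights `d_f` (minus the coefficient of `u^{s_f}`) of the six families:
`2(w₀ + w₂), 2(w₃ + w₅), 2(w₈ + w₉ + w₁₀ + w₁₁), 2 w₁₂, 2(w₁₅ − w₁₆), 2(w₁₇ − w₁₈)`.
[cite: ChesterEtAl2020, §3.1 (unit operator, `V⃗_{0⁺,0,0}`)] -/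
def unitFamD (F : ScanFunctional) (f : Fin 6) (m : Fin F.M) : ℝ :=
  ![2 * (F.w m 0 + F.w m 2), 2 * (F.w m 3 + F.w m 5),
    2 * (F.w m 8 + F.w m 9 + F.w m 10 + F.w m 11), 2 * F.w m 12,
    2 * (F.w m 15 - F.w m 16), 2 * (F.w m 17 - F.w m 18)] f

/-- One node's contribution to the unit number, in closed form. [cite: ChesterEtAl2020, §3.1 (unit operator, `V⃗_{0⁺,0,0}`)] -/
theorem node_unit_eq (F : ScanFunctional) (D : Dims) (m : Fin F.M) :
    ∑ r, F.w m r * (![(1 : ℝ), 1, 1] ⬝ᵥ (V0p D unitBlocks (F.u m) (F.v m) r *ᵥ ![(1 : ℝ), 1, 1])) =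
      ∑ f : Fin 6, (unitFamC F f m * (F.v m) ^ unitFamExpo D f - unitFamD F f m * (F.u m) ^ unitFamExpo D f) := by
  have h : ∀ r, ![(1 : ℝ), 1, 1] ⬝ᵥ (V0p D unitBlocks (F.u m) (F.v m) r *ᵥ ![(1 : ℝ), 1, 1]) =
      quad0p D 1 1 1 unitBlocks (F.u m) (F.v m) r := fun r => rfl
  simp only [h, quad0p_unit, sum_univ_fin22, Fin.sum_univ_six, unitFamC, unitFamD, unitFamExpo]
  simp only [Matrix.cons_val_zero, Matrix.cons_val_one, Matrix.cons_val]
  ring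

/-- **The unit number is the sum of six two-weight evaluations** (constant test function `1`).
[cite: ChesterEtAl2020, §3.1 (unit operator, `V⃗_{0⁺,0,0}`; functional conditions)] -/
theorem unitNumber_eq_families (F : ScanFunctional) (D : Dims) :
    unitNumber F D =
      ∑ f : Fin 6, twoWeightEval (unitFamC F f) (unitFamD F f) F.z F.zb (unitFamExpo D f) (fun _ _ => 1) := by
  unfold unitNumber
  rw [dotProduct_sum_smul_mulVec]
  simp only [node_unit_eq, twoWeightEval, mul_one]
  rw [Finset.sum_comm]
  rfl

/-! ## 2. The corner number of a box of external dimensions -/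

/-- Every family exponent is monotone in the box corners. [cite: ChesterEtAl2020, §3.1 (unit operator, `V⃗_{0⁺,0,0}`)] -/
theorem unitFamExpo_mem_Icc {lo hi D : Dims} (h : InDimBox lo hi D) (f : Fin 6) :
    unitFamExpo D f ∈ Icc (unitFamExpo lo f) (unitFamExpo hi f) := by
  obtain ⟨⟨hs1, hs2⟩, ⟨hp1, hp2⟩, ⟨ht1, ht2⟩⟩ := h
  fin_cases f <;> simp only [unitFamExpo, Fin.zero_eta, Fin.mk_one, Fin.reduceFinMk, Matrix.cons_val_zero,
    Matrix.cons_val_one, Matrix.cons_val, Set.mem_Icc] <;> constructor <;> linarith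

/-- **The corner number of the unit item on a box**: per family, positive parts of the combined weights
at the far corner `s_f(hi)`, negative parts at the near corner `s_f(lo)` (`cornerBound₂ … 0 0 0 s_lo s_hi`).
[cite: ChesterEtAl2020, §3.1 (functional conditions: normalisation on the unit operator)] -/
def unitCorner (F : ScanFunctional) (lo hi : Dims) : ℝ :=
  ∑ f : Fin 6, cornerBound₂ (unitFamC F f) (unitFamD F f) F.z F.zb 0 0 0 (unitFamExpo lo f) (unitFamExpo hi f)

/-- **The corner number is a lower bound of the unit number on the whole box.**
[cite: ChesterEtAl2020, §3.1 (functional conditions: normalisation on the unit operator)] -/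
theorem unitCorner_le_unitNumber (F : ScanFunctional) {lo hi D : Dims} (h : InDimBox lo hi D) :
    unitCorner F lo hi ≤ unitNumber F D := by
  rw [unitNumber_eq_families, ← zMono_zero_zero]
  refine Finset.sum_le_sum fun f _ => ?_
  exact cornerBound₂_le (unitFamC F f) (unitFamD F f) F.z F.zb F.hz F.hzb 0 (E := 0) ⟨le_rfl, le_rfl⟩
    (unitFamExpo_mem_Icc h f)

/-- **Rule (I) on a box of external dimensions.** One closed-form number `unitCorner F lo hi > 0` gives the
unit item `UnitPos F.toFunctional D` for every `D` in the box.
[cite: ChesterEtAl2020, §3.1 (functional conditions: normalisation on the unit operator), §3.3 (scanning over external dimensions)] -/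
theorem unitPos_on_box_of_unitCorner (F : ScanFunctional) {lo hi : Dims} (hI : 0 < unitCorner F lo hi) :
    ∀ D : Dims, InDimBox lo hi D → UnitPos F.toFunctional D := fun D hD =>
  (unitPos_iff F D).2 (hI.trans_le (unitCorner_le_unitNumber F hD))

/-- The per-point case `lo = hi = D`. [cite: ChesterEtAl2020, §3.1 (functional conditions: normalisation on the unit operator)] -/
theorem unitPos_of_unitCorner_self (F : ScanFunctional) {D : Dims} (hI : 0 < unitCorner F D D) :
    UnitPos F.toFunctional D :=
  unitPos_on_box_of_unitCorner F hI D ⟨⟨le_rfl, le_rfl⟩, ⟨le_rfl, le_rfl⟩, ⟨le_rfl, le_rfl⟩⟩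

/-- The same with the box given as a product of closed intervals in `(Δ_s, Δ_φ, Δ_t)` (the shape of the
`Q` of `BoxExcluded A Q`). [cite: ChesterEtAl2020, §3.3 (scanning over external dimensions)] -/
theorem unitPos_on_Icc_of_unitCorner (F : ScanFunctional) {lo hi : Dims} (hI : 0 < unitCorner F lo hi) :
    ∀ D : Dims, (D.Δs, D.Δφ, D.Δt) ∈ Icc lo.Δs hi.Δs ×ˢ (Icc lo.Δφ hi.Δφ ×ˢ Icc lo.Δt hi.Δt) →
      UnitPos F.toFunctional D := fun D hD => by
  simp only [mem_prod, Set.mem_Icc] at hD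
  exact unitPos_on_box_of_unitCorner F hI D ⟨hD.1, hD.2.1, hD.2.2⟩

end Literature.MathematicalPhysics.QuantumFieldTheory.O2DimBox

end
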